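import Literature.AlgebraicTopology.SingularHomology.HomologyRingChange
import Literature.AlgebraicTopology.SingularHomology.FieldBaseChange
import HarnessLib

/-!
# A non-zero class of `Hₙ(X; L)` has a non-zero coordinate class in `Hₙ(X; K)` (`K ⊆ L` fields); hence identities of induced
# maps on `Hₙ(−; K)` ascend to `Hₙ(−; L)` (Hatcher 2002, §3.A: `Hₙ(X; L) ≅ Hₙ(X; K) ⊗_K L` over a field)

Layer `Literature/AlgebraicTopology/SingularHomology`; theorems only (no definition, no named fact). Written by the prover seat
`hodge-nonav-prover-Ax` (g18). A. Hatcher, *Algebraic Topology* (2002), §3.A, Cor. 3A.4 and the closing remark on field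
coefficients: for a field extension `L ⊇ K`, `Hₙ(X; L) ≅ Hₙ(X; K) ⊗_K L`; in coordinates along a `K`-basis `(bᵢ)` of `L` this says
that a class `w ∈ Hₙ(X; L)` is determined by its COORDINATE CLASSES `(bᵢ^*)_* w ∈ Hₙ(X; K)` (change of coefficients along the
`K`-linear coordinate functionals `bᵢ^* : L → K`, the tree's `singularHomology.coeffChange`, Hatcher §2.2 p. 165). The tree's
`FieldBaseChange` proves the chain-level statement (`CChain.exists_bd_eq_of_forall_coord`: an `L`-cycle all of whose coordinate
chains bound is a boundary) and deduces `Hₙ(X; K) = 0 ⇒ Hₙ(X; L) = 0`; this file proves the POINTWISE form and its consequence for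
induced maps:

* `compInv_chainCoeffChange`, `compInv_d`, `compHom_d` — plumbing between Mathlib's singular chains and the concrete model.
* **`exists_coeffChange_coord_ne_zero`** — `w ≠ 0` in `Hₙ(X; L)` ⇒ some coordinate class `(bᵢ^*)_* w ≠ 0` in `Hₙ(X; K)`;
  equivalently `eq_zero_of_forall_coeffChange_coord_eq_zero`.
* **`map_eq_map_of_forall_map_eq_of_algebra`** — if two self-maps `f, g : X → X` (or maps `X → Y`) induce the same map on
  `Hₙ(−; K)`, they induce the same map on `Hₙ(−; L)` (naturality of the change of coefficients, `coeffChange_map`); in particular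
  **`map_eq_id_of_algebra`**: `f_* = id` on `Hₙ(X; K)` ⇒ `f_* = id` on `Hₙ(X; L)`. (Used contrapositively: a self-map known to move
  a COMPLEX class — e.g. by an eigenvector computation over `ℂ` — moves a RATIONAL class.)

## References

* [HatcherAT2002] A. Hatcher, Algebraic Topology, CUP 2002, §2.2 p. 165 (change of coefficients), §3.A Cor. 3A.4 and closing
  remark (field coefficients).
-/

noncomputable section

open CategoryTheory Limits

universe u v

namespace Literature.AlgebraicTopology.SingularHomology

-- the chain modules of the concrete model are `Finsupp`s up to unfolding (as in `HomologyRingChange`)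
set_option backward.isDefEq.respectTransparency false

open singularChainComplex

/-! ### Plumbing: coefficient change and boundaries through the concrete model -/

section Plumbing

variable {R₁ R₂ : Type v} [CommRing R₁] [CommRing R₂] {X : Type u} [TopologicalSpace X]

/-- `g_♯` read on concrete chains is `Finsupp.mapRange g`: `compInv (g_♯ c) = mapRange g (compInv c)`.
[cite: HatcherAT2002, §2.2 p. 165] -/
theorem compInv_chainCoeffChange (g : R₁ →+ R₂) (n : ℕ) (c : (singularChainComplex R₁ R₁ X).X n) :
    (csingularChainComplex.compInv R₂ R₂ X n).hom (chainCoeffChange g n c) =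
      Finsupp.mapRange g (map_zero g) ((csingularChainComplex.compInv R₁ R₁ X n).hom c) := by
  change ((csingularChainComplex.compHom R₂ R₂ X n ≫ csingularChainComplex.compInv R₂ R₂ X n).hom)
      (Finsupp.mapRange.addMonoidHom g ((csingularChainComplex.compInv R₁ R₁ X n).hom c)) = _
  rw [csingularChainComplex.compHom_compInv]
  rfl

/-- The comparison `compHom` commutes with the boundaries: `∂ (compHom y) = compHom (bd y)`. [cite: HatcherAT2002, §2.1] -/
theorem compHom_d (n : ℕ) (y : CChain R₁ X (n + 1)) :
    (singularChainComplex R₁ R₁ X).d (n + 1) n ((csingularChainComplex.compHom R₁ R₁ X (n + 1)).hom y) =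
      (csingularChainComplex.compHom R₁ R₁ X n).hom (csingularChainComplex.bd R₁ n y) := by
  have h := (csingularChainComplex.compIso R₁ R₁ X).hom.comm (n + 1) n
  have h' := congrArg (fun φ => φ.hom y) h
  simp only [ModuleCat.hom_comp, LinearMap.coe_comp, Function.comp_apply, csingularChainComplex.compIso_hom_f] at h'
  rw [csingularChainComplex.d_apply] at h'
  exact h'

/-- The comparison `compInv` commutes with the boundaries: `compInv (∂ c) = bd (compInv c)`. [cite: HatcherAT2002, §2.1] -/
theorem compInv_d (n : ℕ) (c : (singularChainComplex R₁ R₁ X).X (n + 1)) :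
    (csingularChainComplex.compInv R₁ R₁ X n).hom ((singularChainComplex R₁ R₁ X).d (n + 1) n c) =
      csingularChainComplex.bd R₁ n ((csingularChainComplex.compInv R₁ R₁ X (n + 1)).hom c) := by
  -- `c = compHom (compInv c)`
  have hc : c = (csingularChainComplex.compHom R₁ R₁ X (n + 1)).hom ((csingularChainComplex.compInv R₁ R₁ X (n + 1)).hom c) := by
    change c = ((csingularChainComplex.compInv R₁ R₁ X (n + 1) ≫ csingularChainComplex.compHom R₁ R₁ X (n + 1)).hom) c
    rw [csingularChainComplex.compInv_compHom]; rfl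
  conv_lhs => rw [hc, compHom_d]
  change ((csingularChainComplex.compHom R₁ R₁ X n ≫ csingularChainComplex.compInv R₁ R₁ X n).hom) _ = _
  rw [csingularChainComplex.compHom_compInv]
  rfl

end Plumbing

/-! ### Coordinate classes detect homology classes -/

section Detect

variable {K L : Type v} [Field K] [Field L] [Algebra K L] {X Y : Type u} [TopologicalSpace X] [TopologicalSpace Y]

/-- **An `L`-class all of whose coordinate classes vanish is zero.** For a `K`-basis `b` of `L` and `w ∈ Hₙ(X; L)`: if
`(bᵢ^*)_* w = 0` in `Hₙ(X; K)` for every `i` then `w = 0` (write `w = [z]`; every coordinate cycle of `z` bounds, so `z` bounds by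
`CChain.exists_bd_eq_of_forall_coord`). Hatcher §3.A: `Hₙ(X; L) = Hₙ(X; K) ⊗_K L` over a field.
[cite: HatcherAT2002, §3.A Cor. 3A.4 and closing remark (field coefficients)] -/
theorem eq_zero_of_forall_coeffChange_coord_eq_zero {ι : Type*} (b : Module.Basis ι K L) (n : ℕ)
    (w : singularHomology L L X n) (h : ∀ i, singularHomology.coeffChange X (b.coord i).toAddMonoidHom n w = 0) : w = 0 := by
  classical
  obtain ⟨z, rfl⟩ := homologyπ_surjective' n w
  -- each coordinate cycle bounds
  have hb : ∀ i, ∃ e : (singularChainComplex K K X).X (n + 1),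
      (singularChainComplex K K X).d (n + 1) n e = chainCoeffChange (b.coord i).toAddMonoidHom n (iCycles L L X n z) := by
    intro i
    have h0 : (singularChainComplex K K X).homologyπ n (cyclesCoeffChange (b.coord i).toAddMonoidHom n z) = 0 := by
      rw [← singularHomology.coeffChange_homologyπ]; exact h i
    obtain ⟨e, he⟩ := exists_d_eq_iCycles_of_homologyπ_eq_zero' _ h0
    exact ⟨e, by rw [he, iCycles_cyclesCoeffChange]⟩
  -- on concrete chains: every coordinate chain of `c = compInv z` is a boundary
  set c : CChain L X n := (csingularChainComplex.compInv L L X n).hom (iCycles L L X n z) with hc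
  have hcoord : ∀ i, ∃ y : CChain K X (n + 1),
      csingularChainComplex.bd (M := K) K n y = Finsupp.mapRange.linearMap (b.coord i) c := by
    intro i
    obtain ⟨e, he⟩ := hb i
    refine ⟨(csingularChainComplex.compInv K K X (n + 1)).hom e, ?_⟩
    rw [← compInv_d, he, compInv_chainCoeffChange]
    rfl
  obtain ⟨y, hy⟩ := CChain.exists_bd_eq_of_forall_coord b c hcoord
  -- so `z` bounds
  have hE : (singularChainComplex L L X).d (n + 1) n ((csingularChainComplex.compHom L L X (n + 1)).hom y) = iCycles L L X n z := by
    rw [compHom_d, hy, hc]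
    change ((csingularChainComplex.compInv L L X n ≫ csingularChainComplex.compHom L L X n).hom) _ = _
    rw [csingularChainComplex.compInv_compHom]
    rfl
  have hz : z = toCycles L L X (n + 1) n ((csingularChainComplex.compHom L L X (n + 1)).hom y) :=
    cycles_ext (by rw [iCycles_toCycles, hE])
  rw [hz, homologyπ_toCycles]

/-- **A non-zero class of `Hₙ(X; L)` has a non-zero coordinate class in `Hₙ(X; K)`** (`K ⊆ L` fields, `b` a `K`-basis of `L`).
[cite: HatcherAT2002, §3.A Cor. 3A.4 and closing remark (field coefficients)] -/
theorem exists_coeffChange_coord_ne_zero {ι : Type*} (b : Module.Basis ι K L) (n : ℕ) {w : singularHomology L L X n}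
    (hw : w ≠ 0) : ∃ i, singularHomology.coeffChange X (b.coord i).toAddMonoidHom n w ≠ 0 := by
  by_contra! h
  exact hw (eq_zero_of_forall_coeffChange_coord_eq_zero b n w h)

variable (K) in
/-- **Identities of induced maps ascend along a field extension.** If `f, g : X → Y` induce the same map `Hₙ(X; K) → Hₙ(Y; K)`, they
induce the same map `Hₙ(X; L) → Hₙ(Y; L)` (coordinate classes and naturality of the change of coefficients).
[cite: HatcherAT2002, §3.A Cor. 3A.4 with §2.2 p. 165] -/
theorem map_eq_map_of_forall_map_eq_of_algebra (f g : C(X, Y)) (n : ℕ)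
    (h : ∀ x : singularHomology K K X n, singularHomology.map K K f n x = singularHomology.map K K g n x)
    (w : singularHomology L L X n) : singularHomology.map L L f n w = singularHomology.map L L g n w := by
  let b := Module.Basis.ofVectorSpace K L
  rw [← sub_eq_zero]
  refine eq_zero_of_forall_coeffChange_coord_eq_zero b n _ fun i => ?_
  rw [map_sub, singularHomology.coeffChange_map, singularHomology.coeffChange_map, h, sub_self]

variable (K) in
/-- In particular **`f_* = id` on `Hₙ(X; K)` implies `f_* = id` on `Hₙ(X; L)`** for a self-map `f : X → X`; contrapositively, a self-map
that moves some class of `Hₙ(X; L)` moves some class of `Hₙ(X; K)`. [cite: HatcherAT2002, §3.A Cor. 3A.4 with §2.2 p. 165] -/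
theorem map_eq_id_of_algebra (f : C(X, X)) (n : ℕ) (h : ∀ x : singularHomology K K X n, singularHomology.map K K f n x = x)
    (w : singularHomology L L X n) : singularHomology.map L L f n w = w := by
  have h' := map_eq_map_of_forall_map_eq_of_algebra K (L := L) f (ContinuousMap.id X) n
    (fun x => by rw [h x, singularHomology.map_id]; rfl) w
  rw [h', singularHomology.map_id]
  rfl

end Detect

end Literature.AlgebraicTopology.SingularHomology

end
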